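/-
Copyright (c) 2026 the pub-hodgecm-mathlib formalisation cell (harness21).  Prover ∕ assembler seat hodgecm-mathlib-LH4-p01 (g17), STAGE 1a «(D-RAM) FOUR-FRAME» squad of
crux H413 (heir LEAD F0P3a-plan T17-31 (R-9) TIER 2; U0_WildTree cand v3 c43d366e904ab2dc row `stub_U0_fixedSet_subtree`).  2026-09-03.
§2–§3 are ADAPTED from ★ LH5-p04 `UnitaryLatticeTreeEulerRelationRamified` §2–§3 (proofs re-lettered; the tame binders replaced by the datum's conjuncts).
-/
import Literature.NumberTheory.Automorphic.UnitaryLatticeTreeRootStarOrbitWild         -- ★ p854659 (this seat): `forall_flag_exists_unitary_of_ramified` (wild edge transitivity); brings ★ p854568 htr₀-WILD, ★ `…EulerRelationRamified` (FILE 1 dictionaries, fixed flags ≃ edges)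
import Literature.NumberTheory.Automorphic.UnitaryLatticeTreeTypeTwoTransitiveWild       -- ★ p854569 (LH4-p02): `forall_isVertexLattice_two_exists_mapGL_N₁_eq_of_ramified` (htr₂-WILD)
import Literature.NumberTheory.Automorphic.UnitaryLatticeTreeFramesOfInvolution         -- ★ R5d (B-p14): `isTree_latticeGraph_three_of_transitive`
import Literature.NumberTheory.Automorphic.UnitaryThreeFourFrameDefs                     -- ★ #0a: the datum token `IsRamifiedQuadraticDatum σ ϖ d t`
import HarnessLib

/-!
# The lattice graph of a hermitian space — KOTTWITZ'S ELLIPTIC EULER–POINCARÉ RELATION ON THE `U(3)` TREE AT EVERY RAMIFIED PLACE, WILD ONES INCLUDED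
# (Kottwitz 1988 §2; Serre, *Trees* I.6.1, II.1.1; Bruhat–Tits 1972 §10)

Topic `NumberTheory/Automorphic`; namespace `Literature.NumberTheory.Automorphic.UnitaryLatticeTree`.  THEOREMS ONLY (no definition, no instance, no notation, no named fact,
no `sorry`); kernel lane `--supports stmt-HodgeConjecture-24833`.  Cell `pub/hodgecm-mathlib` (D-0151), crux H413; STAGE 1a «(D-RAM) FOUR-FRAME» road, unit U0 (the wild tree),
TIER 2: this file PAYS the tier-1 stub `stub_U0_fixedSet_subtree` of `Cruxes/H413/Lines/F0_P3c_DyRamFourFrame/U0_WildTree.lean` (§4, statement TOKEN FOR TOKEN): the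
(K-1)(c) input `n₀(γ) + n₂(γ) = e(γ) + 1` (the fixed set of `γ` is a finite subtree) of the edge-piece dictionary `stub_U2G_dict_edge`.

* §1 `isTree_latticeGraph_three_of_ramified` — the wild tree in ★ :266's own context (`[ValuativeRel K] [Valued.v.Compatible]`), from htr₀-WILD ★ p854568 and htr₂-WILD ★ p854569.
* §2 `exists_latticeGraphIso_apply_eq_self_three_of_ramified` — a finite `⟨γ⟩`-orbit of the root coset forces a fixed vertex.
* §3 **`natCard_fixedBy_add_eq_natCard_fixedBy_inf_add_one_three_of_ramified`** — the Euler relation.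
* §4 **`fixedSet_subtree_of_isRamifiedQuadraticDatum`** — the same behind the datum token (= `stub_U0_fixedSet_subtree`'s statement).

HONEST LABEL: HC_CM is proved only modulo the 7 printed citations (2 remaining named inputs: hLiu418 = stmt-HodgeConjecture-24832, h413 = stmt-HodgeConjecture-24833) until
rung 0 closes; count-neutral support of unit U0.

## References
* [Kottwitz1988] R. E. Kottwitz, *Tamagawa numbers*, Ann. of Math. 127 (1988), §2 (Euler–Poincaré functions and fixed facets of the building).
* [Serre1980Trees] J.-P. Serre, *Trees* (1980), I.6.1 (a group acting without inversion with a bounded orbit fixes a vertex), II.1.1 (lattice trees).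
* [BruhatTits1972] F. Bruhat, J. Tits, *Groupes réductifs sur un corps local I*, Publ. IHÉS 41 (1972), §3.2, §10.
* [Tits1979] J. Tits, *Reductive groups over local fields*, PSPM 33.1 (1979), §2.7 (p. 48) (rank one: the building is a tree).
-/

set_option autoImplicit false

noncomputable section

open Matrix Literature.NumberTheory.Automorphic Literature.Combinatorics.SimpleGraph
open Literature.NumberTheory.Automorphic.HermitianLattice Literature.NumberTheory.Automorphic.UnitaryGroup Literature.NumberTheory.Automorphic.CartanUnique
open Literature.NumberTheory.Automorphic.UnitaryThreeFourFrame
open scoped Matrix MatrixGroups WithZero Valued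

namespace Literature.NumberTheory.Automorphic.UnitaryLatticeTree

variable {K : Type*} [Field K] [Valued K ℤᵐ⁰] [ValuativeRel K] [(Valued.v : Valuation K ℤᵐ⁰).Compatible]

section ThreeWild

variable {σ : K →+* K} {ϖ : K}

/-! ## §1 The wild tree in ★ :266's context -/

/-- **THE LATTICE GRAPH OF `(K³, J₀)` IS A TREE AT EVERY RAMIFIED QUADRATIC DATUM** (finite residue field): ★ `isTree_latticeGraph_three_of_transitive` with `htr₀` = htr₀-WILD ★
p854568 and `htr₂` = htr₂-WILD ★ p854569 (`hres` from ★ `v_map_sub_self_lt_one_of_even`, `2 ≠ 0` from `|2| = |ϖ|^t`). [cite: BruhatTits1972, §10] [cite: Tits1979, §2.7 (p. 48)] -/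
theorem isTree_latticeGraph_three_of_ramified (hσ : ∀ x, σ (σ x) = x) (hvσ : ∀ a, Valued.v (σ a) = Valued.v a) (hϖ : Valued.v ϖ = WithZero.exp (-1 : ℤ))
    (heven : ∀ x : K, σ x = x → x ≠ 0 → ∃ n : ℤ, Valued.v x = WithZero.exp (2 * n)) {d t : ℕ}
    (hd : Valued.v (ϖ - σ ϖ) = Valued.v ϖ ^ d) (h1d : 1 ≤ d) (h2 : Valued.v (2 : K) = Valued.v ϖ ^ t) [Finite 𝓀[K]] :
    (latticeGraph σ ϖ ((StdForm.antidiagonal 3).over K)).IsTree := by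
  have hϖ0 : ϖ ≠ 0 := uniformizer_ne_zero hϖ
  have h20 : (2 : K) ≠ 0 := fun h => by
    rw [h, map_zero] at h2
    exact pow_ne_zero t ((Valuation.ne_zero_iff Valued.v).2 hϖ0) h2.symm
  exact isTree_latticeGraph_three_of_transitive hσ hvσ hϖ
    (exists_unitary_mapGL_stdLattice_eq_of_isSelfDualLattice_of_ramified hσ hvσ hϖ heven hd h1d h2)
    (forall_isVertexLattice_two_exists_mapGL_N₁_eq_of_ramified hσ hvσ hϖ (fun x hx => v_map_sub_self_lt_one_of_even hσ hϖ heven hd h1d hx) heven h20)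

/-! ## §2–§3 A fixed vertex from a finite orbit; the Euler relation -/

/-- **A vertex fixed by `γ`, ANY RAMIFIED place (wild included)**: if the `⟨γ⟩`-orbit of the root coset `K₀` is finite, `γ` fixes a vertex of the tame-ramified tree (§1 `isTree_latticeGraph_three_of_ramified`;
the orbit of the root is a finite non-empty `γ`-stable vertex set and `γ` preserves the type colouring; ★ `RootedTree.exists_fixedPoint_of_finite_invariant`).  Twin of ★
`exists_latticeGraphIso_apply_eq_self_three_of_neg` with the tame binders replaced by the datum's conjuncts. [cite: Serre1980Trees, I.6.1] [cite: BruhatTits1972, §3.2] -/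
theorem exists_latticeGraphIso_apply_eq_self_three_of_ramified (hσ : ∀ x, σ (σ x) = x) (hvσ : ∀ a, Valued.v (σ a) = Valued.v a) (hϖ : Valued.v ϖ = WithZero.exp (-1 : ℤ)) (heven : ∀ x : K, σ x = x → x ≠ 0 → ∃ n : ℤ, Valued.v x = WithZero.exp (2 * n)) {d t : ℕ}
    (hd : Valued.v (ϖ - σ ϖ) = Valued.v ϖ ^ d) (h1d : 1 ≤ d) (h2 : Valued.v (2 : K) = Valued.v ϖ ^ t) [Finite 𝓀[K]]
    (γ : ↥(unitaryGroupOfForm σ ((StdForm.antidiagonal 3).over K)))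
    (horb : (Set.range fun n : ℕ => ((γ ^ n : ↥(unitaryGroupOfForm σ ((StdForm.antidiagonal 3).over K))) :
      ↥(unitaryGroupOfForm σ ((StdForm.antidiagonal 3).over K)) ⧸ (glInt 3 K).subgroupOf (unitaryGroupOfForm σ ((StdForm.antidiagonal 3).over K)))).Finite) :
    ∃ v : {M : Submodule (Valued.integer K) (Fin 3 → K) // IsVertex σ ϖ ((StdForm.antidiagonal 3).over K) M}, latticeGraphIso σ ϖ ((StdForm.antidiagonal 3).over K) γ v = v := by
  classical
  have hT := isTree_latticeGraph_three_of_ramified hσ hvσ hϖ heven hd h1d h2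
  have hroot : IsSelfDualLattice σ ϖ ((StdForm.antidiagonal 3).over K) (stdLattice K 3) := isSelfDualLattice_stdLattice_three_of_v hϖ
  have hnot : ∀ M : Submodule (Valued.integer K) (Fin 3 → K), IsVertexLattice σ ϖ ((StdForm.antidiagonal 3).over K) 2 M →
      ¬ IsSelfDualLattice σ ϖ ((StdForm.antidiagonal 3).over K) M := fun M hM2 => not_isSelfDualLattice_of_isVertexLattice_two_of_v hvσ hϖ hM2
  -- the type colouring: self-dual ↦ 0, type two ↦ 1
  have hval : ∀ v w : {M : Submodule (Valued.integer K) (Fin 3 → K) // IsVertex σ ϖ ((StdForm.antidiagonal 3).over K) M},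
      (latticeGraph σ ϖ ((StdForm.antidiagonal 3).over K)).Adj v w →
        (if IsSelfDualLattice σ ϖ ((StdForm.antidiagonal 3).over K) v.1 then (0 : Fin 2) else 1) ≠
          (if IsSelfDualLattice σ ϖ ((StdForm.antidiagonal 3).over K) w.1 then (0 : Fin 2) else 1) := by
    intro v w hvw
    rw [latticeGraph_adj_iff] at hvw
    obtain ⟨dv, hv⟩ := v.2
    obtain ⟨dw, hw⟩ := w.2
    rcases hvw with hlt | hlt
    · obtain ⟨rfl, rfl⟩ := type_of_lt_three hvσ hϖ v_det_antidiagonal_three hv hw hlt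
      rw [if_neg (hnot _ hv), if_pos hw]; decide
    · obtain ⟨rfl, rfl⟩ := type_of_lt_three hvσ hϖ v_det_antidiagonal_three hw hv hlt
      rw [if_pos hv, if_neg (hnot _ hw)]; decide
  let c : (latticeGraph σ ϖ ((StdForm.antidiagonal 3).over K)).Coloring (Fin 2) :=
    SimpleGraph.Coloring.mk (fun v => if IsSelfDualLattice σ ϖ ((StdForm.antidiagonal 3).over K) v.1 then (0 : Fin 2) else 1) (fun {v w} hvw => hval v w hvw)
  have hc : ∀ v, c (latticeGraphIso σ ϖ ((StdForm.antidiagonal 3).over K) γ v) = c v := by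
    intro v
    change (if IsSelfDualLattice σ ϖ ((StdForm.antidiagonal 3).over K) (latticeGraphIso σ ϖ ((StdForm.antidiagonal 3).over K) γ v).1 then (0 : Fin 2) else 1) =
      (if IsSelfDualLattice σ ϖ ((StdForm.antidiagonal 3).over K) v.1 then (0 : Fin 2) else 1)
    have h : IsSelfDualLattice σ ϖ ((StdForm.antidiagonal 3).over K) (latticeGraphIso σ ϖ ((StdForm.antidiagonal 3).over K) γ v).1 ↔
        IsSelfDualLattice σ ϖ ((StdForm.antidiagonal 3).over K) v.1 := isVertexLattice_mapGL_iff σ ϖ _ γ v.1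
    rw [show (if IsSelfDualLattice σ ϖ ((StdForm.antidiagonal 3).over K) (latticeGraphIso σ ϖ ((StdForm.antidiagonal 3).over K) γ v).1 then (0 : Fin 2) else 1) =
      (if IsSelfDualLattice σ ϖ ((StdForm.antidiagonal 3).over K) v.1 then (0 : Fin 2) else 1) from by simp only [h]]
  -- the orbit of the root as a vertex set
  let vA : ↥(unitaryGroupOfForm σ ((StdForm.antidiagonal 3).over K)) → {M : Submodule (Valued.integer K) (Fin 3 → K) // IsVertex σ ϖ ((StdForm.antidiagonal 3).over K) M} := fun u =>
    ⟨mapGL (u : GL (Fin 3) K) (stdLattice K 3), ⟨0, isVertexLattice_mapGL σ ϖ _ _ u.2 hroot⟩⟩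
  let f : ↥(unitaryGroupOfForm σ ((StdForm.antidiagonal 3).over K)) ⧸ (glInt 3 K).subgroupOf (unitaryGroupOfForm σ ((StdForm.antidiagonal 3).over K)) →
      {M : Submodule (Valued.integer K) (Fin 3 → K) // IsVertex σ ϖ ((StdForm.antidiagonal 3).over K) M} := fun x =>
    Quotient.liftOn' x vA (by
      intro a b hab
      apply Subtype.ext
      change mapGL _ _ = mapGL _ _
      rw [← mk_eq_mk_iff_mapGL_stdLattice_eq σ ((StdForm.antidiagonal 3).over K) a b]
      exact Quotient.sound' hab)
  have hf : ∀ u : ↥(unitaryGroupOfForm σ ((StdForm.antidiagonal 3).over K)),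
      f (u : ↥(unitaryGroupOfForm σ ((StdForm.antidiagonal 3).over K)) ⧸ (glInt 3 K).subgroupOf (unitaryGroupOfForm σ ((StdForm.antidiagonal 3).over K))) = vA u := fun u => rfl
  refine RootedTree.exists_fixedPoint_of_finite_invariant hT (latticeGraphIso σ ϖ ((StdForm.antidiagonal 3).over K) γ) c hc
    (S := f '' Set.range fun n : ℕ => ((γ ^ n : ↥(unitaryGroupOfForm σ ((StdForm.antidiagonal 3).over K))) :
      ↥(unitaryGroupOfForm σ ((StdForm.antidiagonal 3).over K)) ⧸ (glInt 3 K).subgroupOf (unitaryGroupOfForm σ ((StdForm.antidiagonal 3).over K))))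
    (horb.image f) ⟨f ((γ ^ 0 : ↥(unitaryGroupOfForm σ ((StdForm.antidiagonal 3).over K))) :
      ↥(unitaryGroupOfForm σ ((StdForm.antidiagonal 3).over K)) ⧸ (glInt 3 K).subgroupOf (unitaryGroupOfForm σ ((StdForm.antidiagonal 3).over K))), Set.mem_image_of_mem f ⟨0, rfl⟩⟩ ?_
  rintro s ⟨x, ⟨n, rfl⟩, rfl⟩
  refine ⟨((γ ^ (n + 1) : ↥(unitaryGroupOfForm σ ((StdForm.antidiagonal 3).over K))) :
    ↥(unitaryGroupOfForm σ ((StdForm.antidiagonal 3).over K)) ⧸ (glInt 3 K).subgroupOf (unitaryGroupOfForm σ ((StdForm.antidiagonal 3).over K))), ⟨n + 1, rfl⟩, ?_⟩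
  rw [hf, hf]
  apply Subtype.ext
  rw [latticeGraphIso_apply_coe]
  change mapGL _ _ = mapGL _ (mapGL _ _)
  rw [← mapGL_mul, ← Subgroup.coe_mul, ← pow_succ']

/-- **THE ELLIPTIC EULER–POINCARÉ RELATION ON THE `U(3)` TREE AT EVERY RAMIFIED PLACE, WILD ONES INCLUDED («EULER-G-WILD»).**  `K` with `Valued K ℤᵐ⁰` (and its
valuative relation, for the spelling `glInt`), `σ` an isometric involution, `ϖ` a uniformiser, and the conjuncts of the ramified quadratic datum (`σ`-fixed elements have even
valuation, `|ϖ − σϖ| = |ϖ|^d`, `d ≥ 1`, `|2| = |ϖ|^t`) with a finite residue field — NO `σϖ = −ϖ`, NO `|2| = 1`, NO `hnorm`; `U = U(σ, J₀)(K)`, `K₀ = U ∩ GL₃(𝒪)`,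
`g₁ = diag(1, 1, ϖ)`, `K₁ = U ∩ g₁GL₃(𝒪)g₁⁻¹`.  Then for every `γ ∈ U` with finitely many fixed cosets in `U ⧸ K₀` and `U ⧸ K₁` and a finite `⟨γ⟩`-orbit of the root coset,
`#Fix_γ(U ⧸ K₀) + #Fix_γ(U ⧸ K₁) = #Fix_γ(U ⧸ (K₀ ⊓ K₁)) + 1` — the conclusion of ★ `…_three_of_neg` TOKEN FOR TOKEN (and the statement of the tier-1 stub `stub_U0_fixedSet_subtree`).
PROOF = ★'s, re-lettered: tree §1, (A) htr₀-WILD ★ p854568, (B) htr₂-WILD ★ `forall_isVertexLattice_two_exists_mapGL_N₁_eq_of_ramified`, (I) the wild edge transitivity ★ p854659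
`forall_flag_exists_unitary_of_ramified`, the datum-free dictionaries of ★ FILE 1 and ★ `RootedTree.ncard_fixedPoints_eq_ncard_fixedEdges_add_one`.
[cite: Kottwitz1988, §2] [cite: Serre1980Trees, I.6.1, II.1.1] [cite: BruhatTits1972, §10] [cite: Tits1979, §2.7 (p. 48)] -/
theorem natCard_fixedBy_add_eq_natCard_fixedBy_inf_add_one_three_of_ramified (hσ : ∀ x, σ (σ x) = x) (hvσ : ∀ a, Valued.v (σ a) = Valued.v a) (hϖ : Valued.v ϖ = WithZero.exp (-1 : ℤ)) (heven : ∀ x : K, σ x = x → x ≠ 0 → ∃ n : ℤ, Valued.v x = WithZero.exp (2 * n)) {d t : ℕ}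
    (hd : Valued.v (ϖ - σ ϖ) = Valued.v ϖ ^ d) (h1d : 1 ≤ d) (h2 : Valued.v (2 : K) = Valued.v ϖ ^ t) [Finite 𝓀[K]]
    (g₁ : GL (Fin 3) K) (hg₁ : (g₁ : Matrix (Fin 3) (Fin 3) K) = Matrix.diagonal ![(1 : K), 1, ϖ])
    (γ : ↥(unitaryGroupOfForm σ ((StdForm.antidiagonal 3).over K)))
    (hK₀fin : (MulAction.fixedBy (↥(unitaryGroupOfForm σ ((StdForm.antidiagonal 3).over K)) ⧸
      (glInt 3 K).subgroupOf (unitaryGroupOfForm σ ((StdForm.antidiagonal 3).over K))) γ).Finite)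
    (hK₁fin : (MulAction.fixedBy (↥(unitaryGroupOfForm σ ((StdForm.antidiagonal 3).over K)) ⧸
      ((glInt 3 K).map (MulAut.conj g₁).toMonoidHom).subgroupOf (unitaryGroupOfForm σ ((StdForm.antidiagonal 3).over K))) γ).Finite)
    (horb : (Set.range fun n : ℕ => ((γ ^ n : ↥(unitaryGroupOfForm σ ((StdForm.antidiagonal 3).over K))) :
      ↥(unitaryGroupOfForm σ ((StdForm.antidiagonal 3).over K)) ⧸ (glInt 3 K).subgroupOf (unitaryGroupOfForm σ ((StdForm.antidiagonal 3).over K)))).Finite) :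
    Nat.card (MulAction.fixedBy (↥(unitaryGroupOfForm σ ((StdForm.antidiagonal 3).over K)) ⧸
        (glInt 3 K).subgroupOf (unitaryGroupOfForm σ ((StdForm.antidiagonal 3).over K))) γ) +
      Nat.card (MulAction.fixedBy (↥(unitaryGroupOfForm σ ((StdForm.antidiagonal 3).over K)) ⧸
        ((glInt 3 K).map (MulAut.conj g₁).toMonoidHom).subgroupOf (unitaryGroupOfForm σ ((StdForm.antidiagonal 3).over K))) γ) =
      Nat.card (MulAction.fixedBy (↥(unitaryGroupOfForm σ ((StdForm.antidiagonal 3).over K)) ⧸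
        ((glInt 3 K).subgroupOf (unitaryGroupOfForm σ ((StdForm.antidiagonal 3).over K)) ⊓
          ((glInt 3 K).map (MulAut.conj g₁).toMonoidHom).subgroupOf (unitaryGroupOfForm σ ((StdForm.antidiagonal 3).over K)))) γ) + 1 := by
  classical
  have hϖ0 : ϖ ≠ 0 := uniformizer_ne_zero hϖ
  have hϖ1 : Valued.v ϖ ≤ 1 := uniformizer_mem_integer hϖ
  have h20 : (2 : K) ≠ 0 := fun h => by
    rw [h, map_zero] at h2
    exact pow_ne_zero t ((Valuation.ne_zero_iff Valued.v).2 hϖ0) h2.symm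
  have hres : ∀ x : K, Valued.v x ≤ 1 → Valued.v (σ x - x) < 1 := fun x hx => v_map_sub_self_lt_one_of_even hσ hϖ heven hd h1d hx
  have hT := isTree_latticeGraph_three_of_ramified hσ hvσ hϖ heven hd h1d h2
  have hroot : IsSelfDualLattice σ ϖ ((StdForm.antidiagonal 3).over K) (stdLattice K 3) := isSelfDualLattice_stdLattice_three_of_v hϖ
  have hnot : ∀ M : Submodule (Valued.integer K) (Fin 3 → K), IsVertexLattice σ ϖ ((StdForm.antidiagonal 3).over K) 2 M →
      ¬ IsSelfDualLattice σ ϖ ((StdForm.antidiagonal 3).over K) M := fun M hM2 => not_isSelfDualLattice_of_isVertexLattice_two_of_v hvσ hϖ hM2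
  -- the base edge `N₁ = g₁·L₀ < L₀`
  have hN₁ : mapGL g₁ (stdLattice K 3) = latt (Matrix.diagonal ![(1 : K), 1, ϖ]) := by rw [← hg₁]; rfl
  have hg₁2 : IsVertexLattice σ ϖ ((StdForm.antidiagonal 3).over K) 2 (mapGL g₁ (stdLattice K 3)) := by
    rw [hN₁]; exact isVertexLattice_two_N₁_of_v hvσ hϖ1 hϖ0
  have hlt₁ : mapGL g₁ (stdLattice K 3) < stdLattice K 3 := by
    have h := mapGL_N₁_lt_stdLattice_of_v hvσ hϖ (isVertexLattice_two_N₁_of_v hvσ hϖ1 hϖ0) (Subgroup.one_mem (unitaryInt σ ((StdForm.antidiagonal 3).over K)))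
    rwa [Subgroup.coe_one, mapGL_one, ← hN₁] at h
  -- the three transitivities, for the unramified datum
  have hA : ∀ M : Submodule (Valued.integer K) (Fin 3 → K), IsSelfDualLattice σ ϖ ((StdForm.antidiagonal 3).over K) M →
      ∃ u : ↥(unitaryGroupOfForm σ ((StdForm.antidiagonal 3).over K)), mapGL (u : GL (Fin 3) K) (stdLattice K 3) = M := fun M hM => by
    obtain ⟨u, hu⟩ := exists_unitary_mapGL_stdLattice_eq_of_isSelfDualLattice_of_ramified hσ hvσ hϖ heven hd h1d h2 M hM
    exact ⟨u, hu.symm⟩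
  have hB : ∀ M : Submodule (Valued.integer K) (Fin 3 → K), IsVertexLattice σ ϖ ((StdForm.antidiagonal 3).over K) 2 M →
      ∃ u : ↥(unitaryGroupOfForm σ ((StdForm.antidiagonal 3).over K)), mapGL ((u : GL (Fin 3) K) * g₁) (stdLattice K 3) = M := by
    intro M hM
    obtain ⟨u, hu⟩ := forall_isVertexLattice_two_exists_mapGL_N₁_eq_of_ramified hσ hvσ hϖ hres heven h20 M hM
    exact ⟨u, by rw [mapGL_mul, hN₁, hu]⟩
  have hI := forall_flag_exists_unitary_of_ramified hσ hvσ hϖ heven hd h1d h2 g₁ hg₁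
  obtain ⟨eA, -⟩ := exists_fixedBy_equiv_fixed_selfDual_rankN σ ϖ _ hroot hA γ
  obtain ⟨eB, -⟩ := exists_fixedBy_conj_equiv_fixed_type σ ϖ _ hg₁2 hB γ
  obtain ⟨eI, -⟩ := exists_fixedBy_inf_equiv_fixed_flags_rankN σ ϖ _ hroot hg₁2 hlt₁ hI γ
  obtain ⟨eP⟩ := nonempty_fixed_flags_equiv_fixed_edges_three_of_v hvσ hϖ γ
  haveI : Finite (MulAction.fixedBy (↥(unitaryGroupOfForm σ ((StdForm.antidiagonal 3).over K)) ⧸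
      (glInt 3 K).subgroupOf (unitaryGroupOfForm σ ((StdForm.antidiagonal 3).over K))) γ) := hK₀fin.to_subtype
  haveI : Finite (MulAction.fixedBy (↥(unitaryGroupOfForm σ ((StdForm.antidiagonal 3).over K)) ⧸
      ((glInt 3 K).map (MulAut.conj g₁).toMonoidHom).subgroupOf (unitaryGroupOfForm σ ((StdForm.antidiagonal 3).over K))) γ) := hK₁fin.to_subtype
  have hfinA : {v : {M : Submodule (Valued.integer K) (Fin 3 → K) // IsVertex σ ϖ ((StdForm.antidiagonal 3).over K) M} |
      latticeGraphIso σ ϖ ((StdForm.antidiagonal 3).over K) γ v = v ∧ IsSelfDualLattice σ ϖ ((StdForm.antidiagonal 3).over K) v.1}.Finite :=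
    Set.finite_coe_iff.1 (Finite.of_equiv _ eA)
  have hfinB : {v : {M : Submodule (Valued.integer K) (Fin 3 → K) // IsVertex σ ϖ ((StdForm.antidiagonal 3).over K) M} |
      latticeGraphIso σ ϖ ((StdForm.antidiagonal 3).over K) γ v = v ∧ IsVertexLattice σ ϖ ((StdForm.antidiagonal 3).over K) 2 v.1}.Finite :=
    Set.finite_coe_iff.1 (Finite.of_equiv _ eB)
  have hunion : {v : {M : Submodule (Valued.integer K) (Fin 3 → K) // IsVertex σ ϖ ((StdForm.antidiagonal 3).over K) M} | latticeGraphIso σ ϖ ((StdForm.antidiagonal 3).over K) γ v = v} =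
      {v | latticeGraphIso σ ϖ ((StdForm.antidiagonal 3).over K) γ v = v ∧ IsSelfDualLattice σ ϖ ((StdForm.antidiagonal 3).over K) v.1} ∪
        {v | latticeGraphIso σ ϖ ((StdForm.antidiagonal 3).over K) γ v = v ∧ IsVertexLattice σ ϖ ((StdForm.antidiagonal 3).over K) 2 v.1} := by
    ext v
    simp only [Set.mem_setOf_eq, Set.mem_union]
    constructor
    · intro h
      obtain ⟨d, hvd⟩ := v.2
      rcases type_eq_zero_or_two_of_isVertexLattice_three hvσ hϖ v_det_antidiagonal_three hvd with rfl | rfl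
      · exact Or.inl ⟨h, hvd⟩
      · exact Or.inr ⟨h, hvd⟩
    · rintro (⟨h, -⟩ | ⟨h, -⟩) <;> exact h
  have hfin : {v : {M : Submodule (Valued.integer K) (Fin 3 → K) // IsVertex σ ϖ ((StdForm.antidiagonal 3).over K) M} |
      latticeGraphIso σ ϖ ((StdForm.antidiagonal 3).over K) γ v = v}.Finite := by
    rw [hunion]
    exact hfinA.union hfinB
  obtain ⟨v₀, hv₀⟩ := exists_latticeGraphIso_apply_eq_self_three_of_ramified hσ hvσ hϖ heven hd h1d h2 γ horb
  have hE := RootedTree.ncard_fixedPoints_eq_ncard_fixedEdges_add_one hT (latticeGraphIso σ ϖ ((StdForm.antidiagonal 3).over K) γ) hfin hv₀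
  rw [hunion, Set.ncard_union_eq (Set.disjoint_left.2 fun v hv hv' => hnot _ hv'.2 hv.2) hfinA hfinB] at hE
  rw [Nat.card_congr eA, Nat.card_congr eB, Nat.card_congr (eI.trans eP), Nat.card_coe_set_eq, Nat.card_coe_set_eq, hE, Nat.card_coe_set_eq]


/-! ## §4 The head in the datum token's shape: `stub_U0_fixedSet_subtree`'s statement -/

/-- **KOTTWITZ'S EULER RELATION ON THE WILD TREE — the statement of the tier-1 stub `stub_U0_fixedSet_subtree` of `U0_WildTree`, TOKEN FOR TOKEN** (the datum's conjuncts
fed to §3; completeness and `Fintype` are the sheet's ambient binders). [cite: Kottwitz1988, §2] [cite: Serre1980Trees, I.6.1; II.1.1] -/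
theorem fixedSet_subtree_of_isRamifiedQuadraticDatum :
    ∀ {K : Type} [Field K] [Valued K ℤᵐ⁰] [ValuativeRel K] [(Valued.v : Valuation K ℤᵐ⁰).Compatible] [CompleteSpace K] [Fintype 𝓀[K]]
      (σ : K →+* K) (ϖ : K) (d t : ℕ), IsRamifiedQuadraticDatum σ ϖ d t →
      ∀ (g₁ : GL (Fin 3) K), (g₁ : Matrix (Fin 3) (Fin 3) K) = Matrix.diagonal ![(1 : K), 1, ϖ] →
      ∀ (γ : ↥(unitaryGroupOfForm σ ((StdForm.antidiagonal 3).over K))),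
        (MulAction.fixedBy (↥(unitaryGroupOfForm σ ((StdForm.antidiagonal 3).over K)) ⧸
          (glInt 3 K).subgroupOf (unitaryGroupOfForm σ ((StdForm.antidiagonal 3).over K))) γ).Finite →
        (MulAction.fixedBy (↥(unitaryGroupOfForm σ ((StdForm.antidiagonal 3).over K)) ⧸
          ((glInt 3 K).map (MulAut.conj g₁).toMonoidHom).subgroupOf (unitaryGroupOfForm σ ((StdForm.antidiagonal 3).over K))) γ).Finite →
        (Set.range fun n : ℕ => ((γ ^ n : ↥(unitaryGroupOfForm σ ((StdForm.antidiagonal 3).over K))) :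
          ↥(unitaryGroupOfForm σ ((StdForm.antidiagonal 3).over K)) ⧸ (glInt 3 K).subgroupOf (unitaryGroupOfForm σ ((StdForm.antidiagonal 3).over K)))).Finite →
        Nat.card (MulAction.fixedBy (↥(unitaryGroupOfForm σ ((StdForm.antidiagonal 3).over K)) ⧸
            (glInt 3 K).subgroupOf (unitaryGroupOfForm σ ((StdForm.antidiagonal 3).over K))) γ) +
          Nat.card (MulAction.fixedBy (↥(unitaryGroupOfForm σ ((StdForm.antidiagonal 3).over K)) ⧸
            ((glInt 3 K).map (MulAut.conj g₁).toMonoidHom).subgroupOf (unitaryGroupOfForm σ ((StdForm.antidiagonal 3).over K))) γ) =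
          Nat.card (MulAction.fixedBy (↥(unitaryGroupOfForm σ ((StdForm.antidiagonal 3).over K)) ⧸
            ((glInt 3 K).subgroupOf (unitaryGroupOfForm σ ((StdForm.antidiagonal 3).over K)) ⊓
              ((glInt 3 K).map (MulAut.conj g₁).toMonoidHom).subgroupOf (unitaryGroupOfForm σ ((StdForm.antidiagonal 3).over K)))) γ) + 1 :=
  fun _ _ _ _ hD g₁ hg₁ γ hK₀ hK₁ horb =>
    natCard_fixedBy_add_eq_natCard_fixedBy_inf_add_one_three_of_ramified hD.1 hD.2.1 hD.2.2.1 hD.2.2.2.1 hD.2.2.2.2.1 hD.2.2.2.2.2.1 hD.2.2.2.2.2.2 g₁ hg₁ γ hK₀ hK₁ horb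

end ThreeWild

end Literature.NumberTheory.Automorphic.UnitaryLatticeTree

end
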